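import Summits.KontsevichZagierPeriods.KontsevichZagierPeriods.Theses.UnfoldedStokes
import Summits.KontsevichZagierPeriods.KontsevichZagierPeriods.Theorems.UnfoldedStokesStokesGenerationStubCubifyKernel
import Literature.NumberTheory.Transcendental.KZSemiCanonicalReductionProofs
import Literature.ModelTheory.ExponentialFields.SemialgebraicC1Triangulation

/-!
# Line `c0_cubification` — skeleton for piece `ContinuousCubification` (stmt-KontsevichZagierPeriods-17853)

Crux-strategist r1 (planner-cstrat-stmt-KontsevichZagierPeriods-3586-r1-0), 2026-08-17. Parent: the BC2
split of the RESTATED deciding crux `StokesGeneration` (stmt-3586) of route UnfoldedStokes into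
{`ContinuousCubification` (17853), `PlanarAreas` (4990, shared), `CubeKernelStep` (17854)} with the
proved glue `StokesGenerationOfPieces` (17862).

PIECE: every formal combination `x` is congruent modulo the moves to ONE closed-cube representation
whose integrand is continuous on the CLOSED cube (the line's converse-programme item C4(ii); the s1
census' `C0Cubification`). No transcendence.

LINE (resolution-free; Cresson–Viu-Sos normal form + `C¹`-triangulation):
`x ≡ [[0,1]^M, h]` with `h` bounded (S1 `stub_cubifyKernel`, LANDED) `≡ [A] − [B]` with `A, B`
bounded unit-integrand solids in `ℝ^{M+1}` (`KZ.exists_sub_of_isBounded`, LANDED: sign splitting and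
the regions under the graphs) `≡ [Ā] − [B̄]` compact (`KZ.exists_closure_of_integrand_one`, LANDED:
the frontier of a semialgebraic set is null); then the two STUBS: a `ℚ`-definable `C¹`-triangulation
of each compact solid (`stub_c1TriangulationRat`, the `ℚ`-scope variant of the tree's named fact
`OhmotoShiota2017_c1Triangulation`) and the cubification of a PAIR of triangulated compact unit solids
into one continuous closed-cube representation (`stub_cubifyCompactSolidPair`: rule (1a) over the top
simplices — lower-dimensional images are null —, rule (2) per simplex along `f ∘ A_σ ∘ P` with
`P(t)ᵢ = tᵢ ∏_{k<i} (1 − t_k)` the polynomial cube-to-simplex bijection, whose pulled-back integrand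
`|det D(f ∘ A_σ ∘ P)|` is continuous on the closed cube because `f` is `C¹` up to the closed
simplices, and one rule-(1b) merge of all the cube representations with signs).

Composition `ContinuousCubification_of` is a real proof over the landed reductions (≈ 25 lines).
Sorries: exactly the two stubs.
-/

noncomputable section

set_option linter.dupNamespace false

namespace Summit.KontsevichZagierPeriods.KontsevichZagierPeriods.Cruxes.ContinuousCubification.C0Cubification

open MeasureTheory Set
open Literature.NumberTheory.Transcendental
open Literature.NumberTheory.Transcendental.KZ
open Literature.ModelTheory.ExponentialFields (IsSemialgebraic IsSemialgHomeomorphOn openSimplex)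
open Summit.KontsevichZagierPeriods.KontsevichZagierPeriods.Theses.UnfoldedStokes (ContinuousCubification)
open Summit.KontsevichZagierPeriods.KontsevichZagierPeriods.Cruxes.StokesGeneration.FibrewiseStokes
  (stub_cubifyKernel)

/-- The closed unit cube `[0,1]^M`. -/
abbrev cube (M : ℕ) : Set (Fin M → ℝ) := Set.pi Set.univ (fun _ : Fin M => Set.Icc (0:ℝ) 1)

theorem isCompact_cube (M : ℕ) : IsCompact (cube M) := isCompact_univ_pi fun _ => isCompact_Icc

/-- **ℚ-scope `C¹`-triangulation** (the `ℚ`-definable variant of Ohmoto–Shiota 2017, Thm 1.1 with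
Thm 2.2 / 3.1, printed over any real closed field — apply it over the real closure of `ℚ` and
transfer): `ℚ`-semialgebraic compact input, finite complex with algebraic vertices, `C¹` realisation
`f` whose homeomorphism `|K| → X` (with inverse `g`) has `ℚ`-semialgebraic graph, compatible with a
finite family of `ℚ`-semialgebraic subsets. Verbatim the s1 census' typed `C1TriangulationRat`. -/
def C1TriangulationRat : Prop :=
  ∀ (N : ℕ) (X : Set (Fin N → ℝ)), IsSemialgebraic ℚ X → IsCompact X →
    ∀ 𝒜 : Finset (Set (Fin N → ℝ)), (∀ A ∈ 𝒜, A ⊆ X ∧ IsSemialgebraic ℚ A) →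
      ∃ (n : ℕ) (K : Geometry.SimplicialComplex ℝ (Fin n → ℝ)) (f : (Fin n → ℝ) → (Fin N → ℝ))
        (g : (Fin N → ℝ) → (Fin n → ℝ)),
        K.faces.Finite ∧ (∀ σ ∈ K.faces, ∀ v ∈ σ, ∀ i, IsAlgebraic ℚ (v i)) ∧
          IsSemialgHomeomorphOn ℚ K.space X f g ∧ ContDiff ℝ 1 f ∧
          ∀ A ∈ 𝒜, ∀ σ ∈ K.faces, (f '' openSimplex ℝ σ ∩ A).Nonempty → f '' openSimplex ℝ σ ⊆ A

/-! ## The stubs -/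

/-- STUB T (`L–XL`, a printed theorem to formalise in `ℚ`-scope): the `ℚ`-definable
`C¹`-triangulation of compact `ℚ`-semialgebraic sets. Ohmoto–Shiota 2017, Thm 1.1 (with Thm 2.2,
3.1) is stated over `ℝ` and holds over any real closed field (the tree vendors the `ℝ`-form
`OhmotoShiota2017_c1Triangulation`, with the plain triangulation `semialgebraic_triangulation`
PROVED); the `ℚ`-scope form follows by running the construction over the real closure of `ℚ`
(good directions and barycentres can be taken algebraic) and transferring `C¹`-ness, a first-order
property of semialgebraic maps, to `ℝ`. Also wanted by CobordismMove (wi-15726) and VeryGoodTransfer. -/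
theorem stub_c1TriangulationRat : C1TriangulationRat := by
  sorry

/-- STUB C (`L`): **cubification of a pair of triangulable compact unit solids.** Granted the
`ℚ`-scope `C¹`-triangulation, two compact `ℚ`-semialgebraic solids `K_A, K_B ⊂ ℝ^N` with integrand
`1` are congruent, as the difference `[K_A] − [K_B]`, to ONE closed-cube representation of dimension
`N` whose integrand is continuous on the closed cube. Route: triangulate each solid; `[K, 1] ≡
Σ_{top σ} [f(Int σ), 1]` by rule (1a) (the images of the lower-dimensional open simplices and the
overlaps are null); `[f(Int σ), 1] ≡ [(0,1)^N, |det D(f ∘ A_σ ∘ P)|]` by rule (2) along the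
injective differentiable `ℚ`-semialgebraic chart `f ∘ A_σ ∘ P` (`A_σ` affine onto `σ`, algebraic
entries; `P` the polynomial stick-breaking bijection of the open cube onto the open standard simplex,
Jacobian `∏_k (1 − t_k)^{N−1−k}`), the integrand being continuous on the CLOSED cube because `f` is
`C¹` on closed simplices; pass to the closed cube (null boundary, rule (1a)); merge all cube
representations of the two solids, with signs, into one by rule (1b) (sum of continuous integrands). -/
theorem stub_cubifyCompactSolidPair (hT : C1TriangulationRat) :
    ∀ (N : ℕ) (KA KB : IntegralRep N), IsCompact KA.domain → IsCompact KB.domain →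
      (KA.integrand = fun _ => 1) → (KB.integrand = fun _ => 1) →
      ∃ c : IntegralRep N, c.domain = cube N ∧ ContinuousOn c.integrand c.domain ∧
        of KA - of KB - of c ∈ relations := by
  sorry

/-! ## The composition (real proof over the landed reductions) -/

/-- **`ContinuousCubification` from the two stubs.** `x ≡ [[0,1]^M, h]` (`stub_cubifyKernel`,
landed) `≡ [A] − [B]` bounded unit solids (`exists_sub_of_isBounded`, landed) `≡ [Ā] − [B̄]` compact
(`exists_closure_of_integrand_one`, landed) `≡ [c]` one continuous closed-cube representation (stubs). -/
theorem ContinuousCubification_of (hT : C1TriangulationRat)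
    (hC : C1TriangulationRat → ∀ (N : ℕ) (KA KB : IntegralRep N), IsCompact KA.domain →
      IsCompact KB.domain → (KA.integrand = fun _ => 1) → (KB.integrand = fun _ => 1) →
      ∃ c : IntegralRep N, c.domain = cube N ∧ ContinuousOn c.integrand c.domain ∧
        of KA - of KB - of c ∈ relations) :
    ContinuousCubification := by
  intro x
  obtain ⟨M, t, htd, ⟨B, hB⟩, hxt⟩ := stub_cubifyKernel x
  have hbd : Bornology.IsBounded t.domain := by rw [htd]; exact (isCompact_cube M).isBounded
  obtain ⟨A, A', hAb, hA'b, hAi, hA'i, hrel⟩ := exists_sub_of_isBounded t hbd hB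
  obtain ⟨KA, -, hKAi, hKAc, -, hAK⟩ := exists_closure_of_integrand_one A hAi hAb
  obtain ⟨KB, -, hKBi, hKBc, -, hBK⟩ := exists_closure_of_integrand_one A' hA'i hA'b
  obtain ⟨c, hcd, hcc, hcrel⟩ := hC hT (M + 1) KA KB hKAc hKBc hKAi hKBi
  refine ⟨M + 1, c, hcd, hcc, ?_⟩
  have e : x - of c = (x - of t) + (of t - (of A - of A')) + (of A - of KA) - (of A' - of KB) +
      (of KA - of KB - of c) := by abel
  rw [e]
  exact relations.add_mem (relations.sub_mem (relations.add_mem (relations.add_mem hxt hrel) hAK)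
    hBK) hcrel

/-- The registered composition: the piece's ROUTE DECL by name from the two stubs. -/
theorem ContinuousCubification_of_stubs : ContinuousCubification :=
  ContinuousCubification_of stub_c1TriangulationRat stub_cubifyCompactSolidPair

end Summit.KontsevichZagierPeriods.KontsevichZagierPeriods.Cruxes.ContinuousCubification.C0Cubification

end
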